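import Summits.MatrixMultiplication.OmegaCensus.STPP222DensityBound

/-!
# ω-census (abelian STPP census): the cube density law `10k ≤ |H| + 4`

HONEST FRAMING (pub-omega census; verbatim): lottery ticket; floor = certified bounds/negative ranges.
Census STRUCTURE (seat pub-omega-stpp-1 gen 25, 2026-08-27), family (b2), STRUCTURE question Q7.  Nothing here is progress
on `ω`: a necessary condition on STPP families in finite abelian groups (a tool for EXCLUDING constructions).

## The theorem

For an STPP family `(Aᵢ, Bᵢ, Cᵢ)_{i<k}` (CKSU 2005 Def. 5.1, the tree's `IsSTPP`) in a finite abelian group `H` with all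
`|Aᵢ| = |Bᵢ| = |Cᵢ| = 2`:  **`10·k ≤ |H| + 4`** (`ten_mul_le_card_add_four`), i.e. `k` simultaneous `⟨2,2,2⟩` TPP triples fill at
most `1/10 + o(1)` of a finite abelian group.  This sharpens `STPP222DensityBound.lean` (`28k ≤ 3|H| + 12`, density `3/28`)
and the packing law `8k ≤ |H|` (`STPP222NeverBeats.lean`, density `1/8`, tight at `k = 1`); it is the stronger law for every
`k ≥ 3` (`k = 3: 26 > 24`, `k = 5: 46 > 40`, `k = 10: 96 > 80`).  (Measured onsets: `n₂ = 24, n₃ = 40, n₄ = 56, n₅ = 72`.)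

## Proof

Abstract setting of `STPP222DensityBound.lean` §1: `X, Y, Z ⊆ H` of size `m` (`= 4k`), `rep X Y = 2` on `Z`, every translate
`X + y` (`y ∈ Y`) and `Y + x` (`x ∈ X`) meeting `Z` in at most two points; `σ := 3m − n − 4`; then (`le_dif_of_translate`) every
`δ ∈ Y − Y` has `dif X δ ≥ σ` and every `δ ∈ X − X` has `dif Y δ ≥ σ`.  Assume `2σ > m` (i.e. `5m > 2n + 8`); then `σ > 0`, so
a near-period is a difference and `D := X − X = Y − Y`.  Let `K = Stab(D)`, `κ = #K`, `P = #(X + K)` (`κ ∣ P`).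
* OPEN branch `P ≥ 2κ`: Kneser (tree `add_kneser`, with `−X + K = −(X + K)`) gives `2P ≤ #D + κ`; POINTWISE, for each
  `x ∈ X` the `K`-coset fibre `t(x) = #{x' ∈ X : x − x' ∈ K}` satisfies `t(x) ≥ m + κ − P` (the coset `x − K ⊆ X + K` has at most
  `P − m` holes); the ENERGY IDENTITY `Σ_{δ ∈ D} dif X δ = m²` (all differences of `X` lie in `D`) with `Σ_{δ ∈ K} dif X δ = Σ_x t(x)`
  (`sum_dif_eq_sum_fibre`) leaves `Σ_{δ ∈ D ∖ K} dif X δ ≤ m(P − κ)` for the `#D − κ ≥ 2(P − κ)` near-periods off `K`, each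
  `≥ σ`: so `2(P − κ)σ ≤ m(P − κ)`, `2σ ≤ m`.
* CLOSED branch `X − X = K`: `X + Y` lies in one translate of `D`, which contains `Z` and absorbs all `m²` sums, so
  `#D ≥ 2m − 2`; with `Σ_{δ ∈ D ∖ 0} dif X δ = m² − m ≥ (#D − 1)σ` this gives `(2m − 3)σ ≤ m² − m`, forcing `m ≤ 3`, and
  `m = 3` dies on `#D ≤ n`.
Commutativity is load-bearing (Kneser).  No census input.

References: H. Cohn, R. Kleinberg, B. Szegedy, C. Umans, FOCS 2005 (arXiv:math/0511460), Def. 5.1; M. Kneser, Math. Z. 58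
(1953); M. B. Nathanson, *Additive Number Theory: Inverse Problems*, GTM 165, §4.
-/

open Finset
open scoped Pointwise

namespace Summit.MatrixMultiplication.OmegaCensus.CubeNB

variable {H : Type*} [AddCommGroup H] [DecidableEq H]

/-! ## §1 Stabilizer bookkeeping, symmetric Kneser, the coset dichotomy, the pointwise fibre count -/

section Abstract

variable {X Y Z : Finset H} {m : ℕ}

/-- The stabilizer of a non-empty finset is closed under negation. [cite: Nathanson1996, §4.1] -/
theorem neg_mem_addStab {s : Finset H} (hs : s.Nonempty) {a : H} (ha : a ∈ s.addStab) : -a ∈ s.addStab := by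
  have := sub_mem_addStab hs hs.zero_mem_addStab ha
  rwa [zero_sub] at this

/-- The stabilizer of a non-empty finset is symmetric: `−Stab(s) = Stab(s)`. [cite: Nathanson1996, §4.1] -/
theorem neg_addStab {s : Finset H} (hs : s.Nonempty) : -s.addStab = s.addStab := by
  ext a
  rw [mem_neg']
  constructor
  · intro h
    have := neg_mem_addStab hs h
    rwa [neg_neg] at this
  · intro h
    exact neg_mem_addStab hs h

/-- **Kneser, symmetric form.**  For non-empty `X` and `K = Stab(X − X)`: `2·#(X + K) ≤ #(X − X) + #K`
(Kneser's `#(X + K) + #(−X + K) ≤ #(X − X) + #K` with `−X + K = −(X + K)`). [cite: Kneser1953] -/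
theorem two_mul_card_add_addStab_le (hXne : X.Nonempty) :
    2 * #(X + (X - X).addStab) ≤ #(X - X) + #(X - X).addStab := by
  have hE : X - X = X + -X := sub_eq_add_neg X X
  have hkn := Literature.Combinatorics.Additive.add_kneser X (-X)
  rw [← hE] at hkn
  have hEne : (X - X).Nonempty := hXne.sub hXne
  have hneg : -X + (X - X).addStab = -(X + (X - X).addStab) := by
    rw [neg_add, neg_addStab hEne]
  rw [hneg, card_neg] at hkn
  omega

/-- **Coset dichotomy.**  For non-empty `X` and `K = Stab(X − X)`: either `X` meets at least two cosets of `K`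
(`#(X + K) ≥ 2#K`, from `#K ∣ #(X + K)`), or `X − X = K` (`X` lies in one coset, and then `X − X ⊆ K ⊆ X − X`).
[cite: Nathanson1996, §4.1] -/
theorem coset_dichotomy (hXne : X.Nonempty) :
    2 * #(X - X).addStab ≤ #(X + (X - X).addStab) ∨ X - X = (X - X).addStab := by
  set K := (X - X).addStab with hK
  have hEne : (X - X).Nonempty := hXne.sub hXne
  have hKne : K.Nonempty := hEne.addStab
  have hdvd : #K ∣ #(X + K) := card_addStab_dvd_card_add_addStab X (X - X)
  have h3 : #K ≤ #(X + K) := card_le_card_add_left hXne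
  by_cases hbig : 2 * #K ≤ #(X + K)
  · exact Or.inl hbig
  · right
    have hXK : #(X + K) = #K := by
      obtain ⟨q, hq⟩ := hdvd
      have hq1 : q = 1 := by
        rcases Nat.lt_or_ge q 2 with hq2 | hq2
        · interval_cases q
          · rw [hq, mul_zero] at h3; omega
          · rfl
        · have : #K * 2 ≤ #K * q := Nat.mul_le_mul_left _ hq2
          rw [← hq] at this; omega
      rw [hq, hq1, mul_one]
    have hcoset : ∀ x ∈ X, x +ᵥ K = X + K := fun x hx =>
      eq_of_subset_of_card_le (vadd_finset_subset_add hx) (by rw [hXK, card_vadd_finset])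
    apply Subset.antisymm
    · intro δ hδ
      obtain ⟨x, hx, x', hx', rfl⟩ := mem_sub.1 hδ
      have hmem : x ∈ x' +ᵥ K := by
        rw [hcoset x' hx', ← hcoset x hx]
        exact mem_vadd_finset.2 ⟨0, hEne.zero_mem_addStab, by simp⟩
      obtain ⟨κ, hκ, hxκ⟩ := mem_vadd_finset.1 hmem
      have e : x - x' = κ := by rw [← hxκ, vadd_eq_add]; abel
      rw [e]; exact hκ
    · intro κ hκ
      obtain ⟨x, hx⟩ := hXne
      have h0 : (0 : H) ∈ X - X := mem_sub.2 ⟨x, hx, x, hx, sub_self x⟩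
      have := (mem_addStab' hEne).1 hκ h0
      rwa [vadd_eq_add, add_zero] at this

/-- **Pointwise fibre count.**  For `K ∋ 0` symmetric and `x ∈ X`: the fibre `t(x) = #{x' ∈ X : x − x' ∈ K} = |X ∩ (x − K)|`
satisfies `#X + #K ≤ t(x) + #(X + K)` (the coset `x − K` and `X` both sit inside `X + K`). [folklore] -/
theorem card_add_card_le_fibre_add {K : Finset H} (hKneg : ∀ κ ∈ K, -κ ∈ K) (h0 : (0 : H) ∈ K) {x : H}
    (hx : x ∈ X) : #X + #K ≤ #(X.filter fun x' => x - x' ∈ K) + #(X + K) := by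
  set V := K.image fun κ => x - κ with hV
  have hVc : #V = #K := card_image_of_injective _ sub_right_injective
  have hfil : X.filter (fun x' => x - x' ∈ K) = X ∩ V := by
    ext x'
    simp only [mem_filter, mem_inter, hV, mem_image]
    constructor
    · rintro ⟨hx', hK⟩; exact ⟨hx', x - x', hK, by abel⟩
    · rintro ⟨hx', κ, hκ, rfl⟩; exact ⟨hx', by simpa using hκ⟩
  have hsub : X ∪ V ⊆ X + K := by
    intro g hg
    rcases mem_union.1 hg with hg | hg
    · exact mem_add.2 ⟨g, hg, 0, h0, add_zero g⟩
    · obtain ⟨κ, hκ, rfl⟩ := mem_image.1 hg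
      exact mem_add.2 ⟨x, hx, -κ, hKneg κ hκ, (sub_eq_add_neg x κ).symm⟩
  have h1 := card_union_add_card_inter X V
  have h2 := card_le_card hsub
  rw [hfil]
  omega

/-- Near-periods are differences: if every `δ ∈ Y − Y` has `dif X δ ≥ σ > 0` then `Y − Y ⊆ X − X`. [folklore] -/
theorem sub_subset_sub_of_le_dif {σ : ℕ} (hσ : 0 < σ) (hNP : ∀ δ ∈ Y - Y, σ ≤ dif X δ) : Y - Y ⊆ X - X := by
  intro δ hδ
  have hd := hNP δ hδ
  obtain ⟨x, hx⟩ : (X.filter fun x => x - δ ∈ X).Nonempty := card_pos.1 (by rw [← dif]; omega)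
  rw [mem_filter] at hx
  exact mem_sub.2 ⟨x, hx.1, x - δ, hx.2, by abel⟩

variable [Fintype H]

/-- **Energy identity.**  All differences of `X` lie in `X − X`: `Σ_{δ ∈ X − X} dif X δ = #X²`. [folklore] -/
theorem sum_dif_sub (X : Finset H) : ∑ δ ∈ X - X, dif X δ = #X * #X := by
  rw [sum_subset (subset_univ (X - X)) (fun δ _ hδ => ?_), sum_dif]
  rw [dif, card_eq_zero, filter_eq_empty_iff]
  intro x hx hx'
  exact hδ (mem_sub.2 ⟨x, hx, x - δ, hx', by abel⟩)

/-! ## §2 The abstract bound `5m ≤ 2|H| + 8` -/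

set_option maxHeartbeats 400000 in
/-- **The abstract density bound, sharp form of the method.**  `X, Y, Z ⊆ H` of size `m` with `rep X Y z = 2` on `Z`, every
translate `X + y` (`y ∈ Y`) and `Y + x` (`x ∈ X`) meeting `Z` in at most two points.  Then `5m ≤ 2|H| + 8`
(near-periods, the energy identity on `X − X`, the pointwise fibre count on the cosets of `Stab(X − X)`, Kneser; see the file
header). [cite: Kneser1953] [cite: Nathanson1996, §4.2] -/
theorem five_mul_le_two_mul_card_add (hX : #X = m) (hY : #Y = m) (hZ : #Z = m)
    (hrep : ∀ z ∈ Z, rep X Y z = 2)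
    (hcol : ∀ y ∈ Y, #(X.filter fun x => x + y ∈ Z) ≤ 2)
    (hrow : ∀ x ∈ X, #(Y.filter fun y => y + x ∈ Z) ≤ 2) :
    5 * m ≤ 2 * Fintype.card H + 8 := by
  by_contra hlt
  push Not at hlt
  set n := Fintype.card H with hn
  have hmn : m ≤ n := hX ▸ card_le_univ X
  have hm3 : 3 ≤ m := by omega
  have hXne : X.Nonempty := card_pos.1 (by omega)
  have hYne : Y.Nonempty := card_pos.1 (by omega)
  -- the near-period margin `σ = 3m − n − 4`, with `2σ ≥ m + 1`
  obtain ⟨σ, hσ⟩ : ∃ σ, 3 * m = σ + n + 4 := ⟨3 * m - (n + 4), by omega⟩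
  have h2σ : m + 1 ≤ 2 * σ := by omega
  have hσpos : 0 < σ := by omega
  -- near-periods
  have hNPX : ∀ δ ∈ Y - Y, σ ≤ dif X δ := by
    intro δ hδ
    obtain ⟨y, hy, y', hy', rfl⟩ := mem_sub.1 hδ
    have := le_dif_of_translate hX hZ hcol hy hy'
    omega
  have hNPY : ∀ δ ∈ X - X, σ ≤ dif Y δ := by
    intro δ hδ
    obtain ⟨x, hx, x', hx', rfl⟩ := mem_sub.1 hδ
    have := le_dif_of_translate hY hZ hrow hx hx'
    omega
  have hDeq : X - X = Y - Y :=
    Subset.antisymm (sub_subset_sub_of_le_dif hσpos hNPY) (sub_subset_sub_of_le_dif hσpos hNPX)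
  set D := X - X with hD
  have hNPD : ∀ δ ∈ D, σ ≤ dif X δ := fun δ hδ => hNPX δ (hDeq ▸ hδ)
  have hDne : D.Nonempty := hXne.sub hXne
  set K := D.addStab with hK
  have hKne : K.Nonempty := hDne.addStab
  have hKD : K ⊆ D := by
    intro κ hκ
    obtain ⟨x, hx⟩ := hXne
    have h0 : (0 : H) ∈ D := mem_sub.2 ⟨x, hx, x, hx, sub_self x⟩
    have := (mem_addStab' hDne).1 hκ h0
    rwa [vadd_eq_add, add_zero] at this
  have hDn : #D ≤ n := card_le_univ D
  -- the energy identity on `D`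
  have hE : ∑ δ ∈ D, dif X δ = m * m := by rw [hD, sum_dif_sub, hX]
  rcases coset_dichotomy hXne with hP | hclosed
  · /- OPEN branch: `X` meets at least two cosets of `K` -/
    have hkn := two_mul_card_add_addStab_le hXne
    set P := #(X + K) with hPdef
    change 2 * #K ≤ P at hP
    change 2 * P ≤ #D + #K at hkn
    -- pointwise fibre count, summed over `X`
    set t : H → ℕ := fun x => #(X.filter fun x' => x - x' ∈ K) with ht
    have hfib : ∀ x ∈ X, m + #K ≤ t x + P := by
      intro x hx
      have h := card_add_card_le_fibre_add (X := X) (fun κ hκ => neg_mem_addStab hDne hκ)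
        hDne.zero_mem_addStab hx
      rw [hX] at h
      exact h
    have hsumfib : m * (m + #K) ≤ ∑ x ∈ X, t x + m * P := by
      have h := sum_le_sum hfib
      rw [sum_const, smul_eq_mul, sum_add_distrib, sum_const, smul_eq_mul, hX] at h
      exact h
    have hEK : ∑ δ ∈ K, dif X δ = ∑ x ∈ X, t x := sum_dif_eq_sum_fibre K X
    have hsplit : ∑ δ ∈ D \ K, dif X δ + ∑ δ ∈ K, dif X δ = m * m := by rw [sum_sdiff hKD, hE]
    have hlow : #(D \ K) * σ ≤ ∑ δ ∈ D \ K, dif X δ := by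
      rw [← smul_eq_mul, ← sum_const]
      exact sum_le_sum fun δ hδ => hNPD δ (mem_sdiff.1 hδ).1
    have hKle : #K ≤ #D := card_le_card hKD
    have hcard : #(D \ K) + #K = #D := by rw [card_sdiff_of_subset hKD]; omega
    -- `(#D − κ)σ + mκ ≤ mP`, `#D − κ ≥ 2(P − κ)`, `P ≥ 2κ`  ⇒  `2σ ≤ m`
    obtain ⟨d, hd⟩ : ∃ d, P = #K + d := ⟨P - #K, by omega⟩
    have hdpos : 0 < d := by have := hKne.card_pos; omega
    have hkey : #(D \ K) * σ + m * #K ≤ m * P := by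
      rw [hEK] at hsplit
      nlinarith [hsplit, hlow, hsumfib]
    have hDK : 2 * d ≤ #(D \ K) := by omega
    have h1 : 2 * d * σ ≤ #(D \ K) * σ := Nat.mul_le_mul_right σ hDK
    have hmP : m * P = m * #K + m * d := by rw [hd]; ring
    have h2 : 2 * σ * d ≤ m * d := by nlinarith [hkey, h1, hmP]
    have h3 : 2 * σ ≤ m := Nat.le_of_mul_le_mul_right h2 hdpos
    omega
  · /- CLOSED branch: `D = X − X` is a subgroup; `X + Y` lies in one of its translates -/
    obtain ⟨x₀, hx₀⟩ := hXne
    obtain ⟨y₀, hy₀⟩ := hYne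
    set T := D.image fun δ => x₀ + y₀ + δ with hT
    have hTc : #T = #D := card_image_of_injective _ (add_right_injective (x₀ + y₀))
    have hsumT : ∀ x ∈ X, ∀ y ∈ Y, x + y ∈ T := by
      intro x hx y hy
      have h1 : x - x₀ ∈ D := mem_sub.2 ⟨x, hx, x₀, hx₀, rfl⟩
      have h2 : y - y₀ ∈ D := by rw [hDeq]; exact mem_sub.2 ⟨y, hy, y₀, hy₀, rfl⟩
      have h3 : (x - x₀) +ᵥ (y - y₀) ∈ D := by
        change D = K at hclosed
        rw [hclosed] at h1
        exact (mem_addStab' hDne).1 h1 h2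
      exact mem_image.2 ⟨_, h3, by rw [vadd_eq_add]; abel⟩
    have hrep0 : ∀ g, g ∉ T → rep X Y g = 0 := by
      intro g hg
      rw [rep, card_eq_zero, filter_eq_empty_iff]
      intro x hx hxy
      have := hsumT x hx (g - x) hxy
      rw [add_sub_cancel] at this
      exact hg this
    have hZT : Z ⊆ T := by
      intro z hz
      by_contra h
      have := hrep0 z h
      rw [hrep z hz] at this
      exact absurd this two_ne_zero
    have hsum : ∑ g ∈ T, rep X Y g = m * m := by
      rw [sum_subset (subset_univ T) (fun g _ hg => hrep0 g hg), sum_rep, hX, hY]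
    have hup : ∑ g ∈ T, rep X Y g ≤ 2 * m + (#D - m) * m := by
      rw [← sum_sdiff hZT]
      have h1 : ∑ g ∈ Z, rep X Y g = 2 * m := by
        rw [sum_congr rfl hrep, sum_const, smul_eq_mul, hZ, mul_comm]
      have h2 : ∑ g ∈ T \ Z, rep X Y g ≤ #(T \ Z) * m := by
        rw [← smul_eq_mul]
        exact sum_le_card_nsmul _ _ _ fun g _ => hX ▸ rep_le_left X Y g
      rw [card_sdiff_of_subset hZT, hTc, hZ] at h2
      omega
    have hDm : m ≤ #D := by rw [← hZ, ← hTc]; exact card_le_card hZT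
    obtain ⟨e, he⟩ : ∃ e, #D = m + e := ⟨#D - m, by omega⟩
    have hkey : m * m ≤ 2 * m + e * m := by rw [he, Nat.add_sub_cancel_left] at hup; omega
    have hme : m ≤ 2 + e := by
      have : m * m ≤ (2 + e) * m := by nlinarith
      exact Nat.le_of_mul_le_mul_right this (by omega)
    -- the sharper energy count off `0`: `(#D − 1)σ + m ≤ m²`
    have h0D : (0 : H) ∈ D := mem_sub.2 ⟨x₀, hx₀, x₀, hx₀, sub_self x₀⟩
    have hsharp : (#D - 1) * σ + m ≤ m * m := by
      have hsplit : ∑ δ ∈ D.erase 0, dif X δ + dif X 0 = m * m := by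
        rw [sum_erase_add _ _ h0D, hE]
      have hlow : #(D.erase 0) * σ ≤ ∑ δ ∈ D.erase 0, dif X δ := by
        rw [← smul_eq_mul, ← sum_const]
        exact sum_le_sum fun δ hδ => hNPD δ (mem_of_mem_erase hδ)
      rw [dif_zero, hX] at hsplit
      rw [card_erase_of_mem h0D] at hlow
      omega
    -- arithmetic: `#D = m + e ≥ 2m − 2`, `(#D − 1)σ + m ≤ m²`, `2σ ≥ m + 1`, `#D ≤ n`, `3m = σ + n + 4`
    obtain ⟨d1, hd1⟩ : ∃ d1, d1 + 1 = m + e := ⟨m + e - 1, by omega⟩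
    rw [he, show m + e - 1 = d1 by omega] at hsharp
    obtain ⟨w, hw⟩ : ∃ w, w + 3 = 2 * m := ⟨2 * m - 3, by omega⟩
    have hwd : w ≤ d1 := by omega
    have hA : d1 * (m + 1) ≤ d1 * (2 * σ) := Nat.mul_le_mul_left d1 h2σ
    have hB : w * (m + 1) ≤ d1 * (m + 1) := Nat.mul_le_mul_right (m + 1) hwd
    have hC : w * (m + 1) + 3 * (m + 1) = 2 * (m * m) + 2 * m := by
      rw [← add_mul, hw]; ring
    have hm : m ≤ 3 := by nlinarith [hA, hB, hC, hsharp]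
    omega

/-! ## §3 The cube density law `10k ≤ |H| + 4` -/

open Literature.Computability.AlgebraicComplexity

/-- **THE CUBE DENSITY LAW `10k ≤ |H| + 4`.**  Let `H` be a finite abelian group and `(Aᵢ, Bᵢ, Cᵢ)_{i<k}` an STPP family
(CKSU 2005 Def. 5.1) with all `|Aᵢ| = |Bᵢ| = |Cᵢ| = 2`.  Then `10·k ≤ |H| + 4`: `k` simultaneous `⟨2,2,2⟩` TPP triples fill at
most `1/10 + o(1)` of a finite abelian group (packing law `1/8`, `eight_mul_le_card`; `3/28`, `twentyeight_mul_le_three_mul_card_add`).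
Proof: §2 applied to the three difference families with `rep = |B_j| = 2` on `Z` (`rep_eq_card_B`) and the translate counts
`≤ |A_l|, |C_l| = 2` (`card_filter_add_mem_le_card_A/_C`). [cite: CohnKleinbergSzegedyUmans2005, Def. 5.1] [cite: Kneser1953] -/
theorem ten_mul_le_card_add_four {k : ℕ} {A B C : Fin k → Finset H} (hS : IsSTPP A B C)
    (hc : ∀ i, #(A i) = 2 ∧ #(B i) = 2 ∧ #(C i) = 2) : 10 * k ≤ Fintype.card H + 4 := by
  have hA : ∀ i, (A i).Nonempty := fun i => card_pos.1 (by rw [(hc i).1]; norm_num)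
  have hB : ∀ i, (B i).Nonempty := fun i => card_pos.1 (by rw [(hc i).2.1]; norm_num)
  have hC : ∀ i, (C i).Nonempty := fun i => card_pos.1 (by rw [(hc i).2.2]; norm_num)
  have hX : #(STPPKneser.DU A B univ) = 4 * k := by
    rw [STPPKneser.card_DU_AB hS hC]; simp [hc]; ring
  have hY : #(STPPKneser.DU B C univ) = 4 * k := by
    rw [STPPKneser.card_DU_BC hS hA]; simp [hc]; ring
  have hZ : #(STPPKneser.DU A C univ) = 4 * k := by
    rw [STPPKneser.card_DU_AC hS hB]; simp [hc]; ring
  have hrep : ∀ z ∈ STPPKneser.DU A C univ,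
      rep (STPPKneser.DU A B univ) (STPPKneser.DU B C univ) z = 2 := by
    intro z hz
    obtain ⟨j, -, hz⟩ := mem_biUnion.1 hz
    rw [rep_eq_card_B hS hz, (hc j).2.1]
  have hcol : ∀ y ∈ STPPKneser.DU B C univ,
      #((STPPKneser.DU A B univ).filter fun x => x + y ∈ STPPKneser.DU A C univ) ≤ 2 := by
    intro y hy
    obtain ⟨l, -, hy⟩ := mem_biUnion.1 hy
    exact (card_filter_add_mem_le_card_A hS hy).trans (hc l).1.le
  have hrow : ∀ x ∈ STPPKneser.DU A B univ,
      #((STPPKneser.DU B C univ).filter fun y => y + x ∈ STPPKneser.DU A C univ) ≤ 2 := by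
    intro x hx
    obtain ⟨l, -, hx⟩ := mem_biUnion.1 hx
    exact (card_filter_add_mem_le_card_C hS hx).trans (hc l).2.2.le
  have := five_mul_le_two_mul_card_add hX hY hZ hrep hcol hrow
  omega

/-- Numeric form `|H| ≥ 10k − 4` (natural subtraction). [cite: CohnKleinbergSzegedyUmans2005, Def. 5.1] -/
theorem ten_mul_sub_four_le_card {k : ℕ} {A B C : Fin k → Finset H} (hS : IsSTPP A B C)
    (hc : ∀ i, #(A i) = 2 ∧ #(B i) = 2 ∧ #(C i) = 2) : 10 * k - 4 ≤ Fintype.card H := by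
  have := ten_mul_le_card_add_four hS hc
  omega

/-- `ZMod m` instance: `(2,2,2)^k ⊆ ℤ/m` forces `10k ≤ m + 4`. [cite: CohnKleinbergSzegedyUmans2005, Def. 5.1] -/
theorem ten_mul_le_of_zmod {m k : ℕ} [NeZero m] {A B C : Fin k → Finset (ZMod m)} (hS : IsSTPP A B C)
    (hc : ∀ i, #(A i) = 2 ∧ #(B i) = 2 ∧ #(C i) = 2) : 10 * k ≤ m + 4 := by
  have := ten_mul_le_card_add_four hS hc
  rwa [ZMod.card] at this

end Abstract

end Summit.MatrixMultiplication.OmegaCensus.CubeNB
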